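import Literature.AlgebraicGeometry.HodgeTheory.FermatJacobianRingGorenstein
import HarnessLib

/-!
# The excess bound for a pair of cycle polynomials at the Fermat point (Kloosterman 2025, Lemma 2.9 / Lemma 3.12 / Cor. 3.14, algebraic part)

Topic `Literature/AlgebraicGeometry/HodgeTheory`. R. Kloosterman, *On a conjecture on Hodge loci of linear
combinations of linear subvarieties*, Rend. Circ. Mat. Palermo (2) 74 (2025) = arXiv:2312.12363. §3, for a
smooth hypersurface `X = V(f) ⊂ ℙ^{2k+1}` of degree `d` and two Hodge classes `γ₁, γ₂` with Artinian Gorenstein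
ideals `I₁ = I(γ₁)`, `I₂ = I(γ₂)` (Construction 3.1; socle degree `t = (d−2)(k+1)`) and the pairings
`ψ_j : S_d/(I₁∩I₂)_d × S_{kd−2k−2}/(I₁∩I₂)_{kd−2k−2} → ℂ` (Notation 2.4): **Lemma 3.12** identifies the
excess tangent space `T_X NL(γ₁+λγ₂) / T_X NL(γ₁,γ₂)` with `ker_L(ψ₁ + ν(λ)ψ₂)`, and the printed proof of
**Lemma 2.9** bounds that kernel; **Cor. 3.14**: "Suppose that `h_{I₁+I₂}(kd−2k−2) = 0`, then
`T NL(λ) = T NL(γ₁) ∩ T NL(γ₂)`" (no excess for any `λ`).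

**What this file proves** — the ALGEBRAIC side at the Fermat point, where everything is unconditional
(tree: `FermatJacobianRingGorenstein.lean`, `Kloosterman2025/ArtinianGorensteinOfFunctional.lean`): for the
monomial complete intersection `J = (x_i^e : i ∈ ι)` (the Jacobian ideal of the Fermat polynomial
`Σ x_i^{e+1}`, socle `N = m(e−1)`, `m = #ι`), two forms `P₁, P₂` of the same degree `e₀` with `e₀ + t = N`
(the cycle polynomials `P_{γ_j}` of Construction 3.1 / Duque Franco–Villaflor Def. 2.2, `e₀ = t = N/2` there),
their Gorenstein ideals `I_j = (J : P_j) = annIdeal ℓ_j`, `ℓ_j = coeff_{β₀}(· P_j)` (socle degree `t`), and the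
pairings `ψ_j = gradedMulForm ℓ_j a b` (`a + b = t`; `(a, b) = (d, kd−2k−2)` in the paper):

* `fermat_excess_le_hilbert_sup`: for every `c ≠ 0`,
  `dim ker_L(ψ₁ + c ψ₂)|_{S_a} − dim (I₁ ∩ I₂)_a ≤ h_{I₁+I₂}(b) = dim S_b − dim (I₁ + I₂)_b`
  (the census dictionary "`e(λ) ≤ H = h_{I_Z+I_W}(kd−2k−2)`");
* `fermat_ker_eq_of_hilbert_sup_eq_zero`: if `h_{I₁+I₂}(b) = 0` then the left kernel of `ψ₁ + c ψ₂` on `S_a`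
  is exactly `(I₁ ∩ I₂)_a` for every `c ≠ 0` — Cor. 3.14's "no excess" conclusion at the level of the
  Artinian Gorenstein ideals.

NOT formalised (transcendental): Lemma 3.12's identification of `ker_L` with the quotient of tangent spaces
to Hodge loci, and `I(γ) = (J : P_γ)` for an actual Hodge class (Griffiths / Carlson–Griffiths; tree fact
`Griffiths1969_residues_span_hodgeFiltration`). All statements here are about the ideals `(J : P)` for
arbitrary forms `P`.
-/

noncomputable section

open MvPolynomial Module Literature.RingTheory.MvPolynomial Literature.AlgebraicGeometry.Kloosterman2025
  Literature.AlgebraicGeometry.DuqueFrancoVillaflor2025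

attribute [local instance] MvPolynomial.gradedAlgebra

namespace Literature.AlgebraicGeometry.HodgeTheory

variable {K : Type*} [Field K] {ι : Type*} [Fintype ι] {e : ℕ}

/-- The functional `ℓ_P = coeff_{β₀}(· P)` of a form `P` of degree `e₀` with `e₀ + t = N` is concentrated in
degree `t` (its Gorenstein ideal `(J : P)` has socle `t`). [cite: Kloosterman2025, Construction 3.1, Remark 3.2] -/
theorem fermatSocleFunctional_mulRight_homogeneousComponent {P : MvPolynomial ι K} {e₀ t : ℕ}
    (hP : P.IsHomogeneous e₀) (het : e₀ + t = Fintype.card ι * (e - 1)) (p : MvPolynomial ι K) :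
    (fermatSocleFunctional K ι e ∘ₗ LinearMap.mulRight K P) (homogeneousComponent t p) =
      (fermatSocleFunctional K ι e ∘ₗ LinearMap.mulRight K P) p :=
  comp_mulRight_homogeneousComponent fermatSocleFunctional_homogeneousComponent hP het p

/-- **The excess bound at the Fermat point** (printed proof of Lemma 2.9 + Lemma 3.12, algebraic part): for
`J = (x_i^e)`, forms `P₁, P₂` of degree `e₀`, `e₀ + t = N = m(e−1)`, `I_j = (J : P_j)`, `a + b = t` and
`c ≠ 0`, the left kernel of `ψ₁ + c ψ₂` on `S_a` (where `ψ_j(g,h) = coeff_{β₀}(g h P_j)`) exceeds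
`(I₁ ∩ I₂)_a` by at most `h_{I₁+I₂}(b) = dim S_b − dim (I₁+I₂)_b` dimensions.
[cite: Kloosterman2025, Lemma 2.9 (proof), Lemma 3.12] -/
theorem fermat_excess_le_hilbert_sup (he : 1 ≤ e) {P₁ P₂ : MvPolynomial ι K} {e₀ t : ℕ}
    (hP₁ : P₁.IsHomogeneous e₀) (hP₂ : P₂.IsHomogeneous e₀) (het : e₀ + t = Fintype.card ι * (e - 1))
    {a b : ℕ} (hab : a + b = t) {c : K} (hc : c ≠ 0) :
    finrank K (LinearMap.ker (gradedMulForm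
        (fermatSocleFunctional K ι e ∘ₗ LinearMap.mulRight K P₁ +
          c • (fermatSocleFunctional K ι e ∘ₗ LinearMap.mulRight K P₂)) a b)) -
        finrank K (idealDegree
          ((Ideal.span (Set.range fun i : ι => (X i : MvPolynomial ι K) ^ e)).colon {P₁} ⊓
            (Ideal.span (Set.range fun i : ι => (X i : MvPolynomial ι K) ^ e)).colon {P₂}) a) ≤
      finrank K (homogeneousSubmodule ι K b) -
        finrank K (idealDegree
          ((Ideal.span (Set.range fun i : ι => (X i : MvPolynomial ι K) ^ e)).colon {P₁} ⊔
            (Ideal.span (Set.range fun i : ι => (X i : MvPolynomial ι K) ^ e)).colon {P₂}) b) := by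
  rw [span_X_pow_colon_eq_annIdeal he P₁, span_X_pow_colon_eq_annIdeal he P₂]
  exact excess_le_hilbert_sup (fermatSocleFunctional_mulRight_homogeneousComponent hP₁ het)
    (fermatSocleFunctional_mulRight_homogeneousComponent hP₂ het) hab hc

/-- **Cor. 3.14 at the Fermat point, algebraic part**: if `h_{I₁+I₂}(b) = 0` (`I_j = (J : P_j)`, `a + b = t`),
then for every `c ≠ 0` the left kernel of `ψ₁ + c ψ₂` on `S_a` is exactly `(I₁ ∩ I₂)_a` — no excess at any
`λ`. [cite: Kloosterman2025, Cor. 3.14, Lemma 2.9] -/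
theorem fermat_ker_eq_of_hilbert_sup_eq_zero (he : 1 ≤ e) {P₁ P₂ : MvPolynomial ι K} {e₀ t : ℕ}
    (hP₁ : P₁.IsHomogeneous e₀) (hP₂ : P₂.IsHomogeneous e₀) (het : e₀ + t = Fintype.card ι * (e - 1))
    {a b : ℕ} (hab : a + b = t)
    (hzero : finrank K (homogeneousSubmodule ι K b) -
      finrank K (idealDegree
        ((Ideal.span (Set.range fun i : ι => (X i : MvPolynomial ι K) ^ e)).colon {P₁} ⊔
          (Ideal.span (Set.range fun i : ι => (X i : MvPolynomial ι K) ^ e)).colon {P₂}) b) = 0)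
    {c : K} (hc : c ≠ 0) :
    LinearMap.ker (gradedMulForm
        (fermatSocleFunctional K ι e ∘ₗ LinearMap.mulRight K P₁ +
          c • (fermatSocleFunctional K ι e ∘ₗ LinearMap.mulRight K P₂)) a b) =
      (idealDegree
          ((Ideal.span (Set.range fun i : ι => (X i : MvPolynomial ι K) ^ e)).colon {P₁} ⊓
            (Ideal.span (Set.range fun i : ι => (X i : MvPolynomial ι K) ^ e)).colon {P₂}) a).comap
        (homogeneousSubmodule ι K a).subtype := by
  rw [span_X_pow_colon_eq_annIdeal he P₁, span_X_pow_colon_eq_annIdeal he P₂] at hzero ⊢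
  have h₁ := fermatSocleFunctional_mulRight_homogeneousComponent (K := K) (e := e) hP₁ het
  have h₂ := fermatSocleFunctional_mulRight_homogeneousComponent (K := K) (e := e) hP₂ het
  exact ker_gradedMulForm_add_smul h₁ h₂ hab (idealDegree_sup_eq_top_of_hilbert_eq_zero h₁ h₂ hzero) hc

end Literature.AlgebraicGeometry.HodgeTheory

end
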